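import Literature.NumberTheory.Automorphic.RankinSelbergTorusEulerExact
import HarnessLib

/-!
# The torus integrand of the standard test function is supported on `|a_{n-1}|_v ≤ 1`

Topic `NumberTheory/Automorphic`; namespace `Literature.NumberTheory.Automorphic`. Proof file
(theorems only), an isolated step of `RankinSelbergTorusEulerExact` (Step 3 of
`torusIntegrand_eq_zero_of_not_mem_iUnion`) recorded for the RAMIFIED places: at a point `(a, k)` of the
torus times the maximal compact subgroup, the last row of `diag(a) k` is `a_{n-1} · e_n k`
(`lastRow_glDiagonal_mul`), the standard test function `Φ = Φ_∞ ⊗ 𝟙_{𝒪̂ⁿ}` vanishes unless that row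
is integral at every finite place (`standardTestFun_ne_zero_valued_le_one`), and the row `e_n k_v`
of `k_v ∈ GL_n(𝒪_v)` is primitive (`exists_valued_lastRow_eq_one`). Hence:

* `valued_lastEntry_le_one_of_standardTestFun_ne_zero` — `Φ(e_n diag(a) k) ≠ 0 ⟹ |a_{n-1}|_v ≤ 1`
  for every finite `v`;
* `torusIntegrand_standardTestFun_eq_zero_of_one_lt_valued` — the torus integrand
  `|W(diag(a) k)|² Φ(e_n diag(a) k) |det a|^σ δ_B(a)⁻¹` VANISHES as soon as `|a_{n-1}|_v > 1` at some
  finite place `v`, whatever `W` and `σ` (the support hypothesis of `TorusUnitBoxDecomposition` in the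
  last variable).

This is part of the measure bookkeeping by which the bad-place part of the unfolded Rankin–Selberg
integral at `s = 1` (hypothesis `hfin` of `PairLFunctionPolesEqConjFirstMoment`) is reduced to sums over
valuations. [folklore]

## References

* H. Jacquet, J. A. Shalika, *On Euler products and the classification of automorphic
  representations I*, Amer. J. Math. 103 (1981), §2, §4 [JacquetShalikaAJM1981].
* J. W. Cogdell, *Analytic theory of L-functions for GL_n* (2004), §2.3, proof of Thm. 3.3
  [CogdellAnalyticTheory2004].
-/

noncomputable section

open MeasureTheory Measure NumberField IsDedekindDomain Set Filter Topology
open Literature.NumberTheory.GaloisRepresentations (ideleGroup localUnits)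
open scoped ENNReal NNReal Pointwise

namespace Literature.NumberTheory.Automorphic

section Support

variable {n : ℕ} {K : Type} [Field K] [NumberField K]

/-- **`Φ(e_n diag(a) k) ≠ 0 ⟹ |a_{n-1}|_v ≤ 1`** for the standard test functions, every finite
place `v`, `a` in the torus and `k` in the maximal compact subgroup. [folklore] -/
theorem valued_lastEntry_le_one_of_standardTestFun_ne_zero (hn : 0 < n)
    (Φinf : (Fin n → InfiniteAdeleRing K) → ℝ) (a : Fin n → ideleGroup K) (k : ↥(maximalCompactAdelic n K))
    (hΦ : standardTestFun n K Φinf (lastRow n K (torusPoint n K (a, k))) ≠ 0)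
    (v : HeightOneSpectrum (𝓞 K)) :
    Valued.v (((lastEntry a : ideleGroup K) : AdeleRing (𝓞 K) K).2 v) ≤ 1 := by
  obtain ⟨j, hj⟩ := exists_valued_lastRow_eq_one (K := K) (v := v) hn k
  have hrow := standardTestFun_ne_zero_valued_le_one (v := v) Φinf hΦ j
  have hlr : lastRow n K (torusPoint n K (a, k)) =
      ((lastEntry a : ideleGroup K) : AdeleRing (𝓞 K) K) •
        lastRow n K (show GL (Fin n) (AdeleRing (𝓞 K) K) from (k : (AdelicGroupData.gl n K).Adelic)) :=
    lastRow_glDiagonal_mul a _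
  rw [hlr, Pi.smul_apply, smul_eq_mul, ← AdelicGroupData.adeleEval_apply, map_mul, Valuation.map_mul,
    AdelicGroupData.adeleEval_apply, AdelicGroupData.adeleEval_apply, hj, mul_one] at hrow
  exact hrow

/-- The same for the entry `a ⟨n-1, _⟩`. [folklore] -/
theorem valued_apply_last_le_one_of_standardTestFun_ne_zero (hn : 0 < n)
    (Φinf : (Fin n → InfiniteAdeleRing K) → ℝ) (a : Fin n → ideleGroup K) (k : ↥(maximalCompactAdelic n K))
    (hΦ : standardTestFun n K Φinf (lastRow n K (torusPoint n K (a, k))) ≠ 0)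
    (v : HeightOneSpectrum (𝓞 K)) :
    Valued.v (((a ⟨n - 1, Nat.sub_lt hn one_pos⟩ : ideleGroup K) : AdeleRing (𝓞 K) K).2 v) ≤ 1 := by
  have h := valued_lastEntry_le_one_of_standardTestFun_ne_zero hn Φinf a k hΦ v
  rwa [lastEntry, dif_pos hn] at h

/-- **The torus integrand of a standard test function vanishes when `|a_{n-1}|_v > 1`** at some finite
place `v`, for every `W` and `σ`. [folklore] -/
theorem torusIntegrand_standardTestFun_eq_zero_of_one_lt_valued (hn : 0 < n)
    (W : GL (Fin n) (AdeleRing (𝓞 K) K) → ℂ) (Φinf : (Fin n → InfiniteAdeleRing K) → ℝ) (σ : ℝ)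
    (a : Fin n → ideleGroup K) (k : ↥(maximalCompactAdelic n K)) {v : HeightOneSpectrum (𝓞 K)}
    (hv : 1 < Valued.v (((a ⟨n - 1, Nat.sub_lt hn one_pos⟩ : ideleGroup K) : AdeleRing (𝓞 K) K).2 v)) :
    torusIntegrand n K W (standardTestFun n K Φinf) σ (a, k) = 0 := by
  have hΦ : standardTestFun n K Φinf (lastRow n K (torusPoint n K (a, k))) = 0 := by
    by_contra h
    exact (not_le.2 hv) (valued_apply_last_le_one_of_standardTestFun_ne_zero hn Φinf a k h v)
  rw [torusIntegrand, hΦ, mul_zero, zero_mul, ENNReal.ofReal_zero]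

/-- **Support hypothesis of `TorusUnitBoxDecomposition` in the last variable**: on any box, the torus
integrand of a standard test function vanishes at the points having last entry of `v`-valuation `> 1`.
[folklore] -/
theorem torusIntegrand_standardTestFun_eq_zero_of_exists_last (hn : 0 < n)
    (W : GL (Fin n) (AdeleRing (𝓞 K) K) → ℂ) (Φinf : (Fin n → InfiniteAdeleRing K) → ℝ) (σ : ℝ)
    (k : ↥(maximalCompactAdelic n K)) (v : HeightOneSpectrum (𝓞 K)) (a : Fin n → ideleGroup K)
    (h : ∃ i : Fin n, (i : ℕ) = n - 1 ∧ 1 < Valued.v (((a i : ideleGroup K) : AdeleRing (𝓞 K) K).2 v)) :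
    torusIntegrand n K W (standardTestFun n K Φinf) σ (a, k) = 0 := by
  obtain ⟨i, hi, hlt⟩ := h
  have : i = ⟨n - 1, Nat.sub_lt hn one_pos⟩ := Fin.ext hi
  subst this
  exact torusIntegrand_standardTestFun_eq_zero_of_one_lt_valued hn W Φinf σ a k hlt

end Support

end Literature.NumberTheory.Automorphic
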